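import Summits.ResolutionOfSingularities.ResolutionOfSingularities.Theorems.PurelyInseparableDim4ResConeTwoSlotGame
import Summits.ResolutionOfSingularities.ResolutionOfSingularities.Theorems.PurelyInseparableDim4ResConeKeepBudget
import HarnessLib
import HarnessLib.Audit.Tags

/-!
# Purely inseparable four-folds — TWO-SLOT GAME, SKELETON: readings of the game along a slot-chart tail force a
# constant chart, and a constant-chart tail is a free tail (cell `res-dim4-pi`, K2(p) lane, slice B brick K24a, γ₀)

[OURS · counted 0 · cell `res-dim4-pi` · K2(p) lane (holder res-dim4-p-12 g3, «p-1 takes K24a» 2026-08-29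
01:14Z; statement layer 01:24Z, part γ); the game = res-dim4-idea-4 g3 (bus 00:38:54Z) · seat res-dim4-p-1 g3.]
Nothing here proves K2(p)/K2(5), `NoIsolatedTrap p p` or resolution of singularities in dimension ≥ 4 /
characteristic `p`.  AI kernel work, weaker than expert review.

WHAT THIS FILE PINS.  The two-slot branch (T2) of the light `d = 3` tail (K26b `light_tail_trichotomy`, consumed by
K27a `no_light_powerCone_tail_three_five_of` as `hT2`) is to be killed in three moves: (β) read, in the canonical
Tschirnhaus jet frame at every time, finitely many residual coefficients `s m a b c` / `t m a b c` and prove the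
seven instance hypotheses of the abstract game `…ResConeTwoSlotGame`; (α, landed) the game freezes the chart;
(γ₀, here) a chain whose chart is eventually constant has no satellite steps from some index on, which the
FREE-TAIL THEOREM (`FreeTailProof.noIsolatedFreeTailAt_self`, in the form of p-5's C19
`ResCone.no_constant_chart_tail`, imported) forbids for isolated chains.  So this file proves, for every prime `p`:

* **`no_twoSlot_tail_of_readings`** — if from `k₁` on every chart is one of two letters `A`, `B` (the SLOT
  STEPS of (T2); the rotation steps through the free letter are β4-F's business and are excluded by the
  hypothesis `hslots`) and readings `s t` satisfy the game's instances with `L m := (j (k₁ + m) = A)`, the chain is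
  not all-isolated: `False`.

What remains for the (T2) killer `hT2` is therefore exactly: (β3/β4-S/β5 ✓/β6) the readings and their instances
along slot steps, and (β4-F) the rotation steps.

[cite: CossartJannsenSaito2020, Thm. 3.14, Thm. 9.3] bears_on: LADDER-RESOLUTION:D157-DOOR2 (res-dim4-pi · K2(p) ·
slice B · K24a-γ₀).  Supports stmt-ResolutionOfSingularities-16155 (helper).
-/

set_option linter.dupNamespace false -- mandated namespace of this single-conjunct summit

noncomputable section

namespace Summit.ResolutionOfSingularities.ResolutionOfSingularities.Theorems.PIDim4

namespace ResCone

open MvPolynomial Finset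
open Literature.AlgebraicGeometry.Resolution
open Literature.AlgebraicGeometry.Resolution.CentreBlowup
open Literature.AlgebraicGeometry.Resolution.Hauser2010
open Literature.AlgebraicGeometry.Resolution.HauserPerlega2019

variable {K : Type} [Field K]

/-! ## The skeleton of the two-slot killer -/

/-- **THE TWO-SLOT TAIL, MODULO ITS READINGS** (K24a-γ₀).  Along an isolated witnessed `Step0 p` chain whose
charts from `k₁` on are two letters `A`, `B` only, readings `s t : ℕ → ℕ → ℕ → ℕ → K` (time `m` = chain time
`k₁ + m`) satisfying the instances of the two-slot game for `L m := (j (k₁ + m) = A)` — relabeling `hfix`,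
`hmuA`, `hmuB`, legality `hlegL`, `hlegM`, flag `hflag` — do not exist: the game makes the chart eventually
constant (`twoSlot_eventually_constant`) and a constant chart is a free tail (`no_constant_chart_tail`). [OURS]
[cite: CossartJannsenSaito2020, Thm. 3.14, Thm. 9.3] -/
theorem no_twoSlot_tail_of_readings (p : ℕ) [Fact p.Prime] [CharP K p] [DecidableEq K] {c : ℕ → State K}
    {j : ℕ → Fin 4} {b : ℕ → Fin 4 → K} (hc : ∀ k, IsIsolated p (c k).F ∧ Step0 p (c k) (c (k + 1)))
    (hw : FreeTail.IsWitnessedChain p c j b) {A B : Fin 4} {k₁ : ℕ}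
    (hslots : ∀ k, k₁ ≤ k → j k = A ∨ j k = B) {s t : ℕ → ℕ → ℕ → ℕ → K}
    (hfix : ∀ m, j (k₁ + m) = A → s (m + 1) 1 2 0 = s m 1 2 0)
    (hmuA : ∀ m, j (k₁ + m) ≠ A → s (m + 1) 1 1 0 = s m 1 2 0)
    (hmuB : ∀ m, j (k₁ + m) ≠ A → s (m + 1) 1 2 0 = s m 1 3 0)
    (hlegL : ∀ m, j (k₁ + m) = A → s m 1 1 0 = 0)
    (hlegM : ∀ m, j (k₁ + m) ≠ A → s m 0 2 0 = 0 ∧ s m 1 1 0 = 0 ∧ s m 0 1 1 = 0 ∧ t m 0 1 0 = 0)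
    (hflag : ∀ m, j (k₁ + m) = A → s (m + 1) 0 2 0 ≠ 0 ∨ s (m + 1) 1 1 0 ≠ 0 ∨ s (m + 1) 0 1 1 ≠ 0 ∨
      s (m + 1) 1 2 0 ≠ 0 ∨ s (m + 1) 1 3 0 ≠ 0 ∨ t (m + 1) 0 1 0 ≠ 0) : False := by
  obtain ⟨N, hN⟩ := twoSlot_eventually_constant (L := fun m => j (k₁ + m) = A) hfix hmuA hmuB hlegL hlegM hflag
  rcases hN with hA | hB
  · refine no_constant_chart_tail p hc hw (k₁ := k₁ + N) (h := A) fun k hk => ?_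
    obtain ⟨m, rfl⟩ : ∃ m, k = k₁ + m := ⟨k - k₁, by omega⟩
    exact hA m (by omega)
  · refine no_constant_chart_tail p hc hw (k₁ := k₁ + N) (h := B) fun k hk => ?_
    obtain ⟨m, rfl⟩ : ∃ m, k = k₁ + m := ⟨k - k₁, by omega⟩
    rcases hslots (k₁ + m) (by omega) with h | h
    · exact absurd h (hB m (by omega))
    · exact h

end ResCone

end Summit.ResolutionOfSingularities.ResolutionOfSingularities.Theorems.PIDim4

end
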